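import Literature.Analysis.FluidPDE.MildSolution
import Literature.Analysis.FluidPDE.SolenoidalL2Duality
import Literature.Analysis.UnboundedOperators.HeatGradientSmoothing
import Literature.Analysis.UnboundedOperators.HeatKernelHeatEquation
import Mathlib.MeasureTheory.Integral.MeanInequalities
import HarnessLib

/-!
# The tested difference identity for two `L³` mild solutions and the a priori `L²` bound

Analysis/FluidPDE support file for the uniqueness theorem of Furioli–Lemarié-Rieusset–Terraneo
(`Literature.Analysis.FluidPDE.kato_unique`, reduced in `KatoUniqueness.lean` to the local forward-uniqueness fact
`Fluid.IsMildNSSolutionOn.ae_eq_Ico_of_ae_eq_Icc_three`). For two unforced mild solutions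
`u`, `v` of the Navier–Stokes equations in the duality form `Fluid.IsMildNSSolutionOn` (tested
against divergence-free test fields `φ ∈ 𝒱`, the heat semigroup acting on the test), this file
provides the first step of the `L²`-duality proof of uniqueness in `C([0,T); L³)`
(Lemarié-Rieusset 2016, Thm. 7.7, after Monniaux / Lions–Masmoudi):

* `Fluid.integral_inner_clm_apply_le`: the trilinear bound
  `|∫⟪a, Ψ b⟫| ≤ ‖a‖_{L³} ‖Ψ‖_{L³} ‖b‖_{L³}` (three-factor Hölder `lintegral_enorm_mul_mul_le`);
* `Fluid.eLpNorm_fderiv_heatTest_le`, `Fluid.eLpNorm_fderiv_heatTest_le_rpow`,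
  `Fluid.continuousOn_fderiv_heatTest`: `L^p` contraction, `L^p → L^q` smoothing and joint
  continuity of the gradient of the caloric test field `D(e^{νσΔ}φ)`;
* `Fluid.aestronglyMeasurable_transportPairing`, `Fluid.intervalIntegrable_transportPairing`:
  measurability and integrability in time of `τ ↦ ∫⟪a(τ), D(e^{ν(t-τ)Δ}φ) b(τ)⟫` for jointly
  measurable, `L³`-bounded `a`, `b`;
* `Fluid.IsMildNSSolutionOn.integral_inner_sub_eq` (**tested difference identity**):
  `∫⟪u(t) - v(t), φ⟫ = ∫₀ᵗ [N_u - N_v]`, and the bilinear splitting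
  `Fluid.integral_inner_clm_apply_sub_eq` (`u ⊗ u - v ⊗ v = w ⊗ u + v ⊗ w`);
* `Fluid.IsMildNSSolutionOn.exists_eLpNorm_two_sub_le` (**a priori `L²` bound**, physical
  dimension `3`): `w(t) = u(t) - v(t) ∈ L²` with a bound uniform on `[0, T']`, obtained by
  duality with `𝒱` (`Fluid.memLp_two_of_forall_abs_integral_inner_le`) from
  `|∫⟪w(t), φ⟫| ≤ 4M² C ν^{-3/4} ‖φ‖_{L²} ∫₀ᵗ (t-τ)^{-3/4} dτ`.

## References

* P. G. Lemarié-Rieusset, *The Navier–Stokes problem in the 21st century*, CRC Press 2016,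
  Thm. 7.7 and its proof, pp. 147–149. [cite: LemarieRieusset2016, Thm. 7.7]
* G. Furioli, P. G. Lemarié-Rieusset, E. Terraneo, *Unicité dans `L³(ℝ³)` et d'autres espaces
  fonctionnels limites pour Navier–Stokes*, Rev. Mat. Iberoam. 16 (2000), Thm. 1.
  [cite: FurioliLemarieRieussetTerraneo2000, Thm. 1]
* Y. Giga, M.-H. Giga, J. Saal, *Nonlinear Partial Differential Equations*, Birkhäuser 2010,
  §1.1.3 (`L^p–L^q` smoothing of the heat semigroup). [cite: GigaGigaSaal2010, §1.1.3]
-/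

noncomputable section

open MeasureTheory TopologicalSpace Set Function Filter Topology InnerProductSpace
open scoped RealInnerProductSpace ENNReal NNReal

namespace Literature.Analysis.FluidPDE

variable {E : Type*} [NormedAddCommGroup E] [InnerProductSpace ℝ E] [FiniteDimensional ℝ E]
  [MeasurableSpace E] [BorelSpace E]

/-! ### Three-factor Hölder inequality -/

/-- **Three-factor Hölder inequality** in `lintegral` form: for real exponents `p, q, r > 0` with
`1/p + 1/q + 1/r = 1`, `∫ |a| |b| |c| ≤ ‖a‖_p ‖b‖_q ‖c‖_r` (Mathlib's finite-product Hölder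
`ENNReal.lintegral_prod_norm_pow_le` with three factors). [folklore] -/
theorem lintegral_enorm_mul_mul_le {α : Type*} [MeasurableSpace α] {μ : Measure α}
    {F₁ F₂ F₃ : Type*} [NormedAddCommGroup F₁] [NormedAddCommGroup F₂] [NormedAddCommGroup F₃]
    {a : α → F₁} {b : α → F₂} {c : α → F₃} (ha : AEStronglyMeasurable a μ)
    (hb : AEStronglyMeasurable b μ) (hc : AEStronglyMeasurable c μ) {p q r : ℝ} (hp : 0 < p)
    (hq : 0 < q) (hr : 0 < r) (hpqr : 1 / p + 1 / q + 1 / r = 1) :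
    ∫⁻ x, ‖a x‖ₑ * ‖b x‖ₑ * ‖c x‖ₑ ∂μ ≤
      eLpNorm a (ENNReal.ofReal p) μ * eLpNorm b (ENNReal.ofReal q) μ *
        eLpNorm c (ENNReal.ofReal r) μ := by
  -- the three weighted factors
  set f : Fin 3 → α → ℝ≥0∞ := ![fun x => ‖a x‖ₑ ^ p, fun x => ‖b x‖ₑ ^ q, fun x => ‖c x‖ₑ ^ r]
    with hf
  set w : Fin 3 → ℝ := ![1 / p, 1 / q, 1 / r] with hw
  have hwsum : ∑ i, w i = 1 := by
    simp only [hw, Fin.sum_univ_three, Matrix.cons_val_zero, Matrix.cons_val_one, Matrix.cons_val]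
    simpa [one_div] using hpqr
  have hwnn : ∀ i ∈ (Finset.univ : Finset (Fin 3)), 0 ≤ w i := by
    intro i _
    fin_cases i <;> simp [hw] <;> positivity
  have hfm : ∀ i ∈ (Finset.univ : Finset (Fin 3)), AEMeasurable (f i) μ := by
    intro i _
    fin_cases i
    · exact ha.enorm.pow_const p
    · exact hb.enorm.pow_const q
    · exact hc.enorm.pow_const r
  have hH := ENNReal.lintegral_prod_norm_pow_le Finset.univ hfm hwsum hwnn
  simp only [Fin.prod_univ_three] at hH
  -- pointwise identification of the integrand
  have hpt : ∀ x, f 0 x ^ w 0 * f 1 x ^ w 1 * f 2 x ^ w 2 = ‖a x‖ₑ * ‖b x‖ₑ * ‖c x‖ₑ := by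
    intro x
    simp only [hf, hw, Matrix.cons_val_zero, Matrix.cons_val_one, Matrix.cons_val]
    rw [← ENNReal.rpow_mul, ← ENNReal.rpow_mul, ← ENNReal.rpow_mul,
      mul_one_div_cancel hp.ne', mul_one_div_cancel hq.ne', mul_one_div_cancel hr.ne',
      ENNReal.rpow_one, ENNReal.rpow_one, ENNReal.rpow_one]
  simp_rw [hpt] at hH
  -- identification of the three norms
  have e1 : (∫⁻ x, f 0 x ∂μ) ^ w 0 = eLpNorm a (ENNReal.ofReal p) μ := by
    rw [eLpNorm_eq_lintegral_rpow_enorm_toReal (by simp [hp]) ENNReal.ofReal_ne_top,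
      ENNReal.toReal_ofReal hp.le]
    simp [hf, hw]
  have e2 : (∫⁻ x, f 1 x ∂μ) ^ w 1 = eLpNorm b (ENNReal.ofReal q) μ := by
    rw [eLpNorm_eq_lintegral_rpow_enorm_toReal (by simp [hq]) ENNReal.ofReal_ne_top,
      ENNReal.toReal_ofReal hq.le]
    simp [hf, hw]
  have e3 : (∫⁻ x, f 2 x ∂μ) ^ w 2 = eLpNorm c (ENNReal.ofReal r) μ := by
    rw [eLpNorm_eq_lintegral_rpow_enorm_toReal (by simp [hr]) ENNReal.ofReal_ne_top,
      ENNReal.toReal_ofReal hr.le]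
    simp [hf, hw]
  rw [e1, e2, e3] at hH
  exact hH

/-! ### The caloric test field: gradient bounds -/

section HeatTest

variable {F : Type*} [NormedAddCommGroup F] [NormedSpace ℝ F] [CompleteSpace F]
variable {ν : ℝ}

omit [CompleteSpace F] in
/-- For `σ > 0` the derivative of the caloric test field falls on the data:
`D(e^{νσΔ}φ) = e^{νσΔ} Dφ` for `φ ∈ C¹_c`. [folklore] -/
theorem fderiv_heatTest_of_pos (hν : 0 < ν) {σ : ℝ} (hσ : 0 < σ) {φ : E → F}
    (hφ : ContDiff ℝ 1 φ) (hc : HasCompactSupport φ) (x : E) :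
    fderiv ℝ (heatTest ν φ σ) x = UnboundedOperators.heatExtension (fderiv ℝ φ) (ν * σ) x := by
  rw [heatTest_of_pos hν hσ]
  exact UnboundedOperators.fderiv_heatExtension_of_hasCompactSupport hφ hc _ x

/-- **`L^p` bound of the gradient of the caloric test field**, uniform in time:
`‖D(e^{νσΔ}φ)‖_{L^p} ≤ ‖Dφ‖_{L^p}` for `σ ≥ 0`, `1 ≤ p` (the derivative falls on the data and
`e^{νσΔ}` is an `L^p` contraction, accepted `Literature.Analysis.UnboundedOperators.eLpNorm_heatExtension_le`, discharged). [folklore] -/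
theorem eLpNorm_fderiv_heatTest_le (hν : 0 < ν) {σ : ℝ} (hσ : 0 ≤ σ) {φ : E → F}
    (hφ : ContDiff ℝ 1 φ) (hc : HasCompactSupport φ) {p : ℝ≥0∞} (hp : 1 ≤ p) :
    eLpNorm (fderiv ℝ (heatTest ν φ σ)) p volume ≤ eLpNorm (fderiv ℝ φ) p volume := by
  rcases hσ.eq_or_lt with h | h
  · rw [← h, heatTest_zero_right]
  · have hD : MemLp (fderiv ℝ φ) p volume :=
      (hφ.continuous_fderiv one_ne_zero).memLp_of_hasCompactSupport (hc.fderiv ℝ)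
    have heq : fderiv ℝ (heatTest ν φ σ) = UnboundedOperators.heatExtension (fderiv ℝ φ) (ν * σ) :=
      funext fun x => fderiv_heatTest_of_pos hν h hφ hc x
    rw [heq]
    exact UnboundedOperators.eLpNorm_heatExtension_le_holds hD hp (mul_pos hν h)

/-- The gradient of the caloric test field is in every `L^p`, `1 ≤ p`, for `σ ≥ 0`. [folklore] -/
theorem memLp_fderiv_heatTest (hν : 0 < ν) {σ : ℝ} (hσ : 0 ≤ σ) {φ : E → F}
    (hφ : ContDiff ℝ 1 φ) (hc : HasCompactSupport φ) {p : ℝ≥0∞} (hp : 1 ≤ p) :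
    MemLp (fderiv ℝ (heatTest ν φ σ)) p volume := by
  rcases hσ.eq_or_lt with h | h
  · rw [← h, heatTest_zero_right]
    exact (hφ.continuous_fderiv one_ne_zero).memLp_of_hasCompactSupport (hc.fderiv ℝ)
  · have hD : MemLp (fderiv ℝ φ) p volume :=
      (hφ.continuous_fderiv one_ne_zero).memLp_of_hasCompactSupport (hc.fderiv ℝ)
    have heq : fderiv ℝ (heatTest ν φ σ) = UnboundedOperators.heatExtension (fderiv ℝ φ) (ν * σ) :=
      funext fun x => fderiv_heatTest_of_pos hν h hφ hc x
    rw [heq]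
    exact UnboundedOperators.memLp_heatExtension_holds hD hp (mul_pos hν h)

/-- **Short-time smoothing bound of the gradient of the caloric test field**:
`‖D(e^{νσΔ}φ)‖_{L^q} ≤ C (νσ)^{-1/2 - (n/2)(1/p - 1/q)} ‖φ‖_{L^p}` for `σ > 0`, `1 ≤ p ≤ q`,
with the constant of `Literature.Analysis.UnboundedOperators.eLpNorm_fderiv_heatExtension_le_rpow` (Giga–Giga–Saal 2010, §1.1.3).
[cite: GigaGigaSaal2010, §1.1.3] -/
theorem eLpNorm_fderiv_heatTest_le_rpow (hν : 0 < ν) {p q : ℝ≥0∞} (hp : 1 ≤ p) (hpq : p ≤ q) :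
    ∃ C : ℝ≥0, ∀ (φ : E → F), ContDiff ℝ 1 φ → HasCompactSupport φ → ∀ σ : ℝ, 0 < σ →
      eLpNorm (fderiv ℝ (heatTest ν φ σ)) q volume ≤
        C * ENNReal.ofReal ((ν * σ) ^ (-(1 / 2 : ℝ) -
          ((Module.finrank ℝ E : ℝ) / 2) * ((1 / p).toReal - (1 / q).toReal))) *
          eLpNorm φ p volume := by
  obtain ⟨C, hC⟩ := UnboundedOperators.eLpNorm_fderiv_heatExtension_le_rpow (E := E) (F := F) hp hpq
  refine ⟨C, fun φ hφ hc σ hσ => ?_⟩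
  rw [heatTest_of_pos hν hσ]
  exact hC φ (hφ.continuous.memLp_of_hasCompactSupport hc) (ν * σ) (mul_pos hν hσ)

omit [CompleteSpace F] in
/-- **Joint continuity of the gradient of the caloric test field** `(σ, x) ↦ D(e^{νσΔ}φ)(x)` on
`σ > 0` (derivative falls on the data; tree `continuousOn_uncurry_heatExtension`). [folklore] -/
theorem continuousOn_fderiv_heatTest (hν : 0 < ν) {φ : E → F} (hφ : ContDiff ℝ 1 φ)
    (hc : HasCompactSupport φ) :
    ContinuousOn (fun q : ℝ × E => fderiv ℝ (heatTest ν φ q.1) q.2) (Ioi 0 ×ˢ univ) := by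
  obtain ⟨M, hM⟩ := (hφ.continuous_fderiv one_ne_zero).bounded_above_of_compact_support
    (hc.fderiv ℝ)
  have h := UnboundedOperators.continuousOn_uncurry_heatExtension (hφ.continuous_fderiv one_ne_zero) hM
  have hc2 : Continuous fun q : ℝ × E => ((ν * q.1, q.2) : ℝ × E) := by fun_prop
  have h2 := ContinuousOn.comp (g := fun q : ℝ × E => UnboundedOperators.heatExtension (fderiv ℝ φ) q.1 q.2)
    (f := fun q : ℝ × E => ((ν * q.1, q.2) : ℝ × E)) (s := Ioi 0 ×ˢ univ) h hc2.continuousOn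
    (fun q hq => ⟨mul_pos hν hq.1, mem_univ _⟩)
  refine (h2.congr fun q hq => ?_)
  simp only [Function.comp_def]
  exact fderiv_heatTest_of_pos hν hq.1 hφ hc q.2

end HeatTest

/-! ### The trilinear integrand `⟪a, Ψ(b)⟫` -/

section Trilinear

/-- **Integrability and bound of the transport pairing.** For `a, b ∈ L³(E; E)` and an
operator field `Ψ ∈ L³(E; E →L E)`, the integrand `⟪a(x), Ψ(x) b(x)⟫` is integrable and
`|∫ ⟪a, Ψ b⟫| ≤ ‖a‖₃ ‖Ψ‖₃ ‖b‖₃` (three-factor Hölder). [folklore] -/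
theorem integral_inner_clm_apply_le {a b : E → E} {Ψ : E → E →L[ℝ] E}
    (ha : MemLp a 3 (volume : Measure E)) (hb : MemLp b 3 (volume : Measure E))
    (hΨ : MemLp Ψ 3 (volume : Measure E)) :
    Integrable (fun x => ⟪a x, Ψ x (b x)⟫) volume ∧
      |∫ x, ⟪a x, Ψ x (b x)⟫| ≤
        (eLpNorm a 3 volume * eLpNorm Ψ 3 volume * eLpNorm b 3 volume).toReal := by
  have hmeas : AEStronglyMeasurable (fun x => ⟪a x, Ψ x (b x)⟫) volume := by
    refine ha.1.inner ?_
    exact (isBoundedBilinearMap_apply (𝕜 := ℝ) (E := E) (F := E)).continuous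
      |>.comp_aestronglyMeasurable (hΨ.1.prodMk hb.1)
  have hpt : ∀ x, ‖⟪a x, Ψ x (b x)⟫‖ₑ ≤ ‖a x‖ₑ * ‖Ψ x‖ₑ * ‖b x‖ₑ := fun x => by
    have h : ‖⟪a x, Ψ x (b x)⟫‖ ≤ ‖a x‖ * ‖Ψ x‖ * ‖b x‖ := by
      calc ‖⟪a x, Ψ x (b x)⟫‖ ≤ ‖a x‖ * ‖Ψ x (b x)‖ := norm_inner_le_norm _ _
        _ ≤ ‖a x‖ * (‖Ψ x‖ * ‖b x‖) :=
            mul_le_mul_of_nonneg_left (ContinuousLinearMap.le_opNorm _ _) (norm_nonneg _)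
        _ = ‖a x‖ * ‖Ψ x‖ * ‖b x‖ := by ring
    calc ‖⟪a x, Ψ x (b x)⟫‖ₑ = ENNReal.ofReal ‖⟪a x, Ψ x (b x)⟫‖ := (ofReal_norm _).symm
      _ ≤ ENNReal.ofReal (‖a x‖ * ‖Ψ x‖ * ‖b x‖) := ENNReal.ofReal_le_ofReal h
      _ = ‖a x‖ₑ * ‖Ψ x‖ₑ * ‖b x‖ₑ := by
          rw [ENNReal.ofReal_mul (by positivity), ENNReal.ofReal_mul (by positivity),
            ofReal_norm, ofReal_norm, ofReal_norm]
  have h3 : ENNReal.ofReal (3 : ℝ) = 3 := by norm_num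
  have hH : ∫⁻ x, ‖⟪a x, Ψ x (b x)⟫‖ₑ ≤ eLpNorm a 3 volume * eLpNorm Ψ 3 volume * eLpNorm b 3 volume := by
    have h := lintegral_enorm_mul_mul_le (μ := (volume : Measure E)) ha.1 hΨ.1 hb.1
      (p := 3) (q := 3) (r := 3) (by norm_num) (by norm_num) (by norm_num) (by norm_num)
    rw [h3] at h
    exact (lintegral_mono fun x => hpt x).trans h
  have hfin : eLpNorm a 3 volume * eLpNorm Ψ 3 volume * eLpNorm b 3 volume < ⊤ :=
    ENNReal.mul_lt_top (ENNReal.mul_lt_top ha.2 hΨ.2) hb.2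
  refine ⟨⟨hmeas, hH.trans_lt hfin⟩, ?_⟩
  rw [← Real.norm_eq_abs]
  refine (norm_integral_le_lintegral_norm _).trans (ENNReal.toReal_mono hfin.ne ?_)
  simpa only [ofReal_norm] using hH

end Trilinear


/-! ### Measurability and integrability in time of the transport pairing -/

section TimePairing

variable {ν T t : ℝ} {φ : E → E} {a b : ℝ → E → E}

/-- The restricted Lebesgue measure on a time slab `(0, T) × E` is the product of the restricted
time measure with Lebesgue measure on `E`. [folklore] -/
theorem volume_restrict_slab_eq_prod (a b : ℝ) :
    (volume : Measure (ℝ × E)).restrict (Ioo a b ×ˢ univ) =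
      (volume.restrict (Ioo a b)).prod (volume : Measure E) := by
  rw [show (volume : Measure (ℝ × E)) = (volume : Measure ℝ).prod (volume : Measure E) from rfl,
    ← Measure.restrict_univ (μ := (volume : Measure E)), Measure.prod_restrict,
    Measure.restrict_univ]

/-- Joint measurability on a smaller time slab. [folklore] -/
theorem aestronglyMeasurable_uncurry_mono (htT : t ≤ T)
    (ha : AEStronglyMeasurable (uncurry a) ((volume : Measure (ℝ × E)).restrict (Ioo 0 T ×ˢ univ))) :
    AEStronglyMeasurable (uncurry a) ((volume.restrict (Ioo 0 t)).prod (volume : Measure E)) := by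
  rw [← volume_restrict_slab_eq_prod]
  exact ha.mono_measure (Measure.restrict_mono (prod_mono (Ioo_subset_Ioo le_rfl htT) le_rfl) le_rfl)

/-- **Measurability in time of the transport pairing**
`τ ↦ ∫ ⟪a(τ), D(e^{ν(t-τ)Δ}φ) b(τ)⟫` on `(0, t)`, for jointly measurable `a, b` and a `C¹_c`
test field `φ` (the operator field `(τ, x) ↦ D(e^{ν(t-τ)Δ}φ)(x)` is jointly continuous on
`τ < t`; then Fubini measurability `AEStronglyMeasurable.integral_prod_right'`). [folklore] -/
theorem aestronglyMeasurable_transportPairing (hν : 0 < ν) (hφ : ContDiff ℝ 1 φ)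
    (hc : HasCompactSupport φ) (htT : t ≤ T)
    (ha : AEStronglyMeasurable (uncurry a) ((volume : Measure (ℝ × E)).restrict (Ioo 0 T ×ˢ univ)))
    (hb : AEStronglyMeasurable (uncurry b) ((volume : Measure (ℝ × E)).restrict (Ioo 0 T ×ˢ univ))) :
    AEStronglyMeasurable
      (fun τ => ∫ x, ⟪a τ x, fderiv ℝ (heatTest ν φ (t - τ)) x (b τ x)⟫)
      (volume.restrict (Ioo 0 t)) := by
  set μ : Measure (ℝ × E) := (volume.restrict (Ioo 0 t)).prod (volume : Measure E) with hμ
  have ha' := aestronglyMeasurable_uncurry_mono htT ha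
  have hb' := aestronglyMeasurable_uncurry_mono htT hb
  -- the operator field is continuous on `τ < t`
  have hΨc : ContinuousOn (fun q : ℝ × E => fderiv ℝ (heatTest ν φ (t - q.1)) q.2)
      (Iio t ×ˢ univ) := by
    have hc2 : Continuous fun q : ℝ × E => ((t - q.1, q.2) : ℝ × E) := by fun_prop
    have h := ContinuousOn.comp (g := fun q : ℝ × E => fderiv ℝ (heatTest ν φ q.1) q.2)
      (f := fun q : ℝ × E => ((t - q.1, q.2) : ℝ × E)) (s := Iio t ×ˢ univ)
      (continuousOn_fderiv_heatTest hν hφ hc) hc2.continuousOn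
      (fun q hq => ⟨show (0 : ℝ) < t - q.1 from sub_pos.2 hq.1, mem_univ _⟩)
    simpa only [Function.comp_def] using h
  have hΨm : AEStronglyMeasurable (fun q : ℝ × E => fderiv ℝ (heatTest ν φ (t - q.1)) q.2) μ := by
    have h := (hΨc.mono (prod_mono (Ioo_subset_Iio_self (a := (0 : ℝ))) (subset_univ _))).aestronglyMeasurable
      (μ := (volume : Measure (ℝ × E))) (measurableSet_Ioo.prod MeasurableSet.univ)
    rwa [volume_restrict_slab_eq_prod] at h
  have hH : AEStronglyMeasurable
      (fun q : ℝ × E => ⟪uncurry a q, fderiv ℝ (heatTest ν φ (t - q.1)) q.2 (uncurry b q)⟫) μ :=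
    ha'.inner ((isBoundedBilinearMap_apply (𝕜 := ℝ) (E := E) (F := E)).continuous
      |>.comp_aestronglyMeasurable (hΨm.prodMk hb'))
  exact hH.integral_prod_right'

/-- **Interval integrability in time of the transport pairing** on `[0, t]`, for `a, b` jointly
measurable with `‖a(τ)‖_{L³} ≤ M_a`, `‖b(τ)‖_{L³} ≤ M_b` on `[0, t]`: the pairing is measurable
and bounded by `M_a ‖Dφ‖_{L³} M_b` (`integral_inner_clm_apply_le`, `eLpNorm_fderiv_heatTest_le`).
[folklore] -/
theorem intervalIntegrable_transportPairing (hν : 0 < ν) (hφ : ContDiff ℝ 1 φ)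
    (hc : HasCompactSupport φ) (ht0 : 0 ≤ t) (htT : t ≤ T)
    (ha : AEStronglyMeasurable (uncurry a) ((volume : Measure (ℝ × E)).restrict (Ioo 0 T ×ˢ univ)))
    (hb : AEStronglyMeasurable (uncurry b) ((volume : Measure (ℝ × E)).restrict (Ioo 0 T ×ˢ univ)))
    {Ma Mb : ℝ≥0∞} (hMa : Ma < ⊤) (hMb : Mb < ⊤)
    (ha3 : ∀ τ ∈ Icc 0 t, MemLp (a τ) 3 (volume : Measure E) ∧ eLpNorm (a τ) 3 volume ≤ Ma)
    (hb3 : ∀ τ ∈ Icc 0 t, MemLp (b τ) 3 (volume : Measure E) ∧ eLpNorm (b τ) 3 volume ≤ Mb) :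
    IntervalIntegrable
      (fun τ => ∫ x, ⟪a τ x, fderiv ℝ (heatTest ν φ (t - τ)) x (b τ x)⟫) volume 0 t := by
  rw [intervalIntegrable_iff_integrableOn_Ioc_of_le ht0, integrableOn_Ioc_iff_integrableOn_Ioo]
  have hDφ : MemLp (fderiv ℝ φ) 3 (volume : Measure E) :=
    (hφ.continuous_fderiv one_ne_zero).memLp_of_hasCompactSupport (hc.fderiv ℝ)
  set B : ℝ := (Ma * eLpNorm (fderiv ℝ φ) 3 volume * Mb).toReal with hB
  haveI : IsFiniteMeasure (volume.restrict (Ioo (0 : ℝ) t)) :=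
    isFiniteMeasure_restrict.2 measure_Ioo_lt_top.ne
  refine Integrable.mono' (integrable_const B)
    (aestronglyMeasurable_transportPairing hν hφ hc htT ha hb) ?_
  refine (ae_restrict_iff' measurableSet_Ioo).2 (Eventually.of_forall fun τ hτ => ?_)
  have hτ' : τ ∈ Icc 0 t := ⟨hτ.1.le, hτ.2.le⟩
  have hΨ : MemLp (fderiv ℝ (heatTest ν φ (t - τ))) 3 (volume : Measure E) :=
    memLp_fderiv_heatTest hν (sub_nonneg.2 hτ.2.le) hφ hc (by norm_num)
  have h := (integral_inner_clm_apply_le (ha3 τ hτ').1 (hb3 τ hτ').1 hΨ).2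
  rw [Real.norm_eq_abs]
  refine h.trans (ENNReal.toReal_mono ?_ ?_)
  · exact (ENNReal.mul_lt_top (ENNReal.mul_lt_top hMa hDφ.2) hMb).ne
  · gcongr
    · exact (ha3 τ hτ').2
    · exact eLpNorm_fderiv_heatTest_le hν (sub_nonneg.2 hτ.2.le) hφ hc (by norm_num)
    · exact (hb3 τ hτ').2

end TimePairing

/-! ### The tested difference identity -/

section Difference

variable {ν T : ℝ} {u v : ℝ → E → E} {u₀ : E → E}

/-- **The tested difference identity.** For two unforced mild solutions `u`, `v` on `[0, T)` with
the same datum (duality form `Fluid.IsMildNSSolutionOn (Ico 0 T) ν 0 u₀`), a time `t ∈ [0, T)` and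
a divergence-free test field `φ`, under the integrability of the pairings involved,
`∫ ⟪u(t) - v(t), φ⟫ = ∫₀ᵗ [N_u(τ) - N_v(τ)] dτ` with
`N_u(τ) = ∫ ⟪u(τ), (u(τ)·∇) e^{ν(t-τ)Δ}φ⟫`: the datum terms `∫ ⟪u₀, e^{νtΔ}φ⟫` cancel and the
force terms vanish (Lemarié-Rieusset 2016, proof of Thm. 7.7, second step, (7.54): the equation
for `w = u - v` has no free term). [cite: LemarieRieusset2016, proof of Thm. 7.7 (7.54) p. 148] -/
theorem IsMildNSSolutionOn.integral_inner_sub_eq (h₁ : IsMildNSSolutionOn (Ico 0 T) ν 0 u₀ u)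
    (h₂ : IsMildNSSolutionOn (Ico 0 T) ν 0 u₀ v) {t : ℝ} (ht : t ∈ Ico 0 T) {φ : E → E}
    (hφ : FunctionSpaces.IsTestFunctionOn (⊤ : Opens E) φ) (hφd : VectorCalculus.IsDivFree φ)
    (iu : Integrable (fun x => ⟪u t x, φ x⟫) volume) (iv : Integrable (fun x => ⟪v t x, φ x⟫) volume)
    (Iu : IntervalIntegrable
      (fun τ => ∫ x, ⟪u τ x, convect (u τ) (heatTest ν φ (t - τ)) x⟫) volume 0 t)
    (Iv : IntervalIntegrable
      (fun τ => ∫ x, ⟪v τ x, convect (v τ) (heatTest ν φ (t - τ)) x⟫) volume 0 t) :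
    ∫ x, ⟪u t x - v t x, φ x⟫ =
      ∫ τ in 0..t, ((∫ x, ⟪u τ x, convect (u τ) (heatTest ν φ (t - τ)) x⟫) -
        ∫ x, ⟪v τ x, convect (v τ) (heatTest ν φ (t - τ)) x⟫) := by
  have e₁ := h₁.2 t ht φ hφ hφd
  have e₂ := h₂.2 t ht φ hφ hφd
  simp only [Pi.zero_apply, inner_zero_left, integral_zero, intervalIntegral.integral_zero,
    add_zero] at e₁ e₂
  simp_rw [inner_sub_left]
  rw [integral_sub iu iv, e₁, e₂, intervalIntegral.integral_sub Iu Iv]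
  ring

/-- **Bilinear splitting of the nonlinear terms** at a fixed time: with `w = u - v` and an
operator field `Ψ` (all in `L³`),
`∫⟪u, Ψ u⟫ - ∫⟪v, Ψ v⟫ = ∫⟪w, Ψ u⟫ + ∫⟪v, Ψ w⟫` (Lemarié-Rieusset 2016, (7.54):
`u ⊗ u - v ⊗ v = w ⊗ u + v ⊗ w`). [folklore] -/
theorem integral_inner_clm_apply_sub_eq {a b : E → E} {Ψ : E → E →L[ℝ] E}
    (ha : MemLp a 3 (volume : Measure E)) (hb : MemLp b 3 (volume : Measure E))
    (hΨ : MemLp Ψ 3 (volume : Measure E)) :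
    (∫ x, ⟪a x, Ψ x (a x)⟫) - ∫ x, ⟪b x, Ψ x (b x)⟫ =
      (∫ x, ⟪(a - b) x, Ψ x (a x)⟫) + ∫ x, ⟪b x, Ψ x ((a - b) x)⟫ := by
  have hw : MemLp (a - b) 3 (volume : Measure E) := ha.sub hb
  have i1 := (integral_inner_clm_apply_le ha ha hΨ).1
  have i2 := (integral_inner_clm_apply_le hb hb hΨ).1
  have i3 := (integral_inner_clm_apply_le hw ha hΨ).1
  have i4 := (integral_inner_clm_apply_le hb hw hΨ).1
  rw [← integral_sub i1 i2, ← integral_add i3 i4]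
  refine integral_congr_ae (Eventually.of_forall fun x => ?_)
  simp only [Pi.sub_apply, inner_sub_left, map_sub, inner_sub_right]
  ring

end Difference


/-! ### The a priori `L²` bound of the difference -/

section APrioriL2

variable {ν T : ℝ} {u v : ℝ → E → E} {u₀ : E → E}

/-- `∫_a^t (t - τ)^{-3/4} dτ = 4 (t - a)^{1/4}`. [folklore] -/
theorem integral_rpow_neg_three_quarters (a t : ℝ) :
    ∫ τ in a..t, (t - τ) ^ (-(3 / 4 : ℝ)) = 4 * (t - a) ^ (1 / 4 : ℝ) := by
  rw [intervalIntegral.integral_comp_sub_left (fun σ : ℝ => σ ^ (-(3 / 4 : ℝ))) t, sub_self,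
    integral_rpow (Or.inl (by norm_num))]
  have hr : (-(3 / 4 : ℝ)) + 1 = 1 / 4 := by norm_num
  rw [hr, Real.zero_rpow (by norm_num)]
  ring

/-- **Pointwise-in-time bound of the difference of the nonlinear pairings**: for `a, b ∈ L³` with
`‖a‖_{L³}, ‖b‖_{L³} ≤ M` and an operator field `Ψ ∈ L³`,
`|∫⟪a, Ψ a⟫ - ∫⟪b, Ψ b⟫| ≤ 4 M² ‖Ψ‖_{L³}` (bilinear splitting + Hölder). [folklore] -/
theorem abs_integral_inner_clm_apply_sub_le {a b : E → E} {Ψ : E → E →L[ℝ] E} {M : ℝ≥0}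
    (ha : MemLp a 3 (volume : Measure E)) (hb : MemLp b 3 (volume : Measure E))
    (hΨ : MemLp Ψ 3 (volume : Measure E)) (haM : eLpNorm a 3 volume ≤ M)
    (hbM : eLpNorm b 3 volume ≤ M) :
    |(∫ x, ⟪a x, Ψ x (a x)⟫) - ∫ x, ⟪b x, Ψ x (b x)⟫| ≤
      4 * (M : ℝ) ^ 2 * (eLpNorm Ψ 3 (volume : Measure E)).toReal := by
  rw [integral_inner_clm_apply_sub_eq ha hb hΨ]
  have hw : MemLp (a - b) 3 (volume : Measure E) := ha.sub hb
  have b1 := (integral_inner_clm_apply_le hw ha hΨ).2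
  have b2 := (integral_inner_clm_apply_le hb hw hΨ).2
  have hwM : eLpNorm (a - b) 3 volume ≤ ((M + M : ℝ≥0) : ℝ≥0∞) :=
    ((eLpNorm_sub_le ha.1 hb.1 (by norm_num)).trans (add_le_add haM hbM)).trans_eq
      (ENNReal.coe_add M M).symm
  have h1 : (eLpNorm (a - b) 3 volume).toReal ≤ M + M := by
    have := ENNReal.toReal_mono ENNReal.coe_ne_top hwM
    rwa [ENNReal.coe_toReal, NNReal.coe_add] at this
  have h2 : (eLpNorm a 3 volume).toReal ≤ M := by
    have := ENNReal.toReal_mono ENNReal.coe_ne_top haM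
    rwa [ENNReal.coe_toReal] at this
  have h3 : (eLpNorm b 3 volume).toReal ≤ M := by
    have := ENNReal.toReal_mono ENNReal.coe_ne_top hbM
    rwa [ENNReal.coe_toReal] at this
  have e1 : (eLpNorm (a - b) 3 volume * eLpNorm Ψ 3 volume * eLpNorm a 3 volume).toReal ≤
      (M + M) * (eLpNorm Ψ 3 (volume : Measure E)).toReal * M := by
    rw [ENNReal.toReal_mul, ENNReal.toReal_mul]
    gcongr
  have e2 : (eLpNorm b 3 volume * eLpNorm Ψ 3 volume * eLpNorm (a - b) 3 volume).toReal ≤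
      M * (eLpNorm Ψ 3 (volume : Measure E)).toReal * (M + M) := by
    rw [ENNReal.toReal_mul, ENNReal.toReal_mul]
    gcongr
  calc |(∫ x, ⟪(a - b) x, Ψ x (a x)⟫) + ∫ x, ⟪b x, Ψ x ((a - b) x)⟫|
      ≤ |∫ x, ⟪(a - b) x, Ψ x (a x)⟫| + |∫ x, ⟪b x, Ψ x ((a - b) x)⟫| := abs_add_le _ _
    _ ≤ (M + M) * (eLpNorm Ψ 3 (volume : Measure E)).toReal * M +
          M * (eLpNorm Ψ 3 (volume : Measure E)).toReal * (M + M) :=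
        add_le_add (b1.trans e1) (b2.trans e2)
    _ = 4 * (M : ℝ) ^ 2 * (eLpNorm Ψ 3 (volume : Measure E)).toReal := by ring

/-- **A priori `L²` bound of the difference of two `L³` mild solutions** (physical dimension
`3`). Let `u`, `v` be unforced mild solutions on `[0, T)` (duality form) with the same datum,
jointly measurable on the slab and bounded in `L³` by `M` on `[0, T']`, `T' < T`. Then for every
`t ∈ [0, T']` the difference `w(t) = u(t) - v(t)` lies in `L²` with
`‖w(t)‖_{L²} ≤ 16 M² C ν^{-3/4} T'^{1/4}`, `C` the `L² → L³` gradient smoothing constant of the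
heat semigroup. Proof: by the tested difference identity and the bilinear bound,
`|∫⟪w(t), φ⟫| ≤ 4M² ∫₀ᵗ ‖D e^{ν(t-τ)Δ}φ‖_{L³} dτ ≤ 4M² C ν^{-3/4} ‖φ‖_{L²} ∫₀ᵗ (t-τ)^{-3/4} dτ`
for every `φ ∈ 𝒱`, and the `L²` duality with `𝒱` for weakly divergence-free fields
(`memLp_two_of_forall_abs_integral_inner_le`). This is the whole-space form of the first step of
the proof of Thm. 7.7 in Lemarié-Rieusset 2016 (there: `w ∈ L⁴L²` via
`B(u,v) ∈ L^∞ Ḃ^{1/2}_{2,∞}`); here the smoothing estimate of the Oseen kernel is used at the level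
of tests. [cite: LemarieRieusset2016, proof of Thm. 7.7, first step, pp. 147–148] -/
theorem IsMildNSSolutionOn.exists_eLpNorm_two_sub_le (hd : Module.finrank ℝ E = 3) (hν : 0 < ν)
    (h₁ : IsMildNSSolutionOn (Ico 0 T) ν 0 u₀ u) (h₂ : IsMildNSSolutionOn (Ico 0 T) ν 0 u₀ v)
    (hmu : AEStronglyMeasurable (uncurry u)
      ((volume : Measure (ℝ × E)).restrict (Ioo 0 T ×ˢ univ)))
    (hmv : AEStronglyMeasurable (uncurry v)
      ((volume : Measure (ℝ × E)).restrict (Ioo 0 T ×ˢ univ)))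
    {T' : ℝ} (hT' : T' < T) {M : ℝ≥0}
    (hu3 : ∀ τ ∈ Icc 0 T', MemLp (u τ) 3 (volume : Measure E) ∧ eLpNorm (u τ) 3 volume ≤ M)
    (hv3 : ∀ τ ∈ Icc 0 T', MemLp (v τ) 3 (volume : Measure E) ∧ eLpNorm (v τ) 3 volume ≤ M) :
    ∃ A : ℝ, ∀ t ∈ Icc 0 T', MemLp (u t - v t) 2 (volume : Measure E) ∧
      eLpNorm (u t - v t) 2 volume ≤ ENNReal.ofReal A := by
  obtain ⟨C, hC⟩ := eLpNorm_fderiv_heatTest_le_rpow (E := E) (F := E) hν (p := 2) (q := 3)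
    one_le_two (by norm_num)
  have hexp : (-(1 / 2 : ℝ) - ((Module.finrank ℝ E : ℝ) / 2) *
      ((1 / (2 : ℝ≥0∞)).toReal - (1 / (3 : ℝ≥0∞)).toReal)) = -(3 / 4 : ℝ) := by
    rw [hd, ENNReal.toReal_div, ENNReal.toReal_div]
    norm_num
  set K : ℝ := 4 * (M : ℝ) ^ 2 * ((C : ℝ) * ν ^ (-(3 / 4 : ℝ))) with hK
  have hK0 : 0 ≤ K := by positivity
  refine ⟨K * (4 * T' ^ (1 / 4 : ℝ)), fun t ht => ?_⟩
  have hT'0 : 0 ≤ T' := ht.1.trans ht.2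
  have htT : t ∈ Ico 0 T := ⟨ht.1, ht.2.trans_lt hT'⟩
  have hu3t : ∀ τ ∈ Icc 0 t, MemLp (u τ) 3 (volume : Measure E) ∧ eLpNorm (u τ) 3 volume ≤ M :=
    fun τ hτ => hu3 τ ⟨hτ.1, hτ.2.trans ht.2⟩
  have hv3t : ∀ τ ∈ Icc 0 t, MemLp (v τ) 3 (volume : Measure E) ∧ eLpNorm (v τ) 3 volume ≤ M :=
    fun τ hτ => hv3 τ ⟨hτ.1, hτ.2.trans ht.2⟩
  have hw3 : MemLp (u t - v t) 3 (volume : Measure E) := (hu3 t ht).1.sub (hv3 t ht).1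
  have hdiv : IsWeaklyDivFree (u t - v t) :=
    (h₁.1 t htT).sub_of_locallyIntegrable (h₂.1 t htT)
      ((hu3 t ht).1.locallyIntegrable (by norm_num)) ((hv3 t ht).1.locallyIntegrable (by norm_num))
  refine memLp_two_of_forall_abs_integral_inner_le (by norm_num) (by simp) hw3 hdiv
    (by positivity) fun φ hφ hφd => ?_
  have hφ1 : ContDiff ℝ 1 φ := contDiff_infty.1 hφ.contDiff 1
  have hφc : HasCompactSupport φ := hφ.hasCompactSupport
  have hφ2 : MemLp φ 2 (volume : Measure E) := hφ.contDiff.continuous.memLp_of_hasCompactSupport hφc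
  -- integrability of the pairings at time `t`, and of the nonlinear pairings on `[0, t]`
  have iu : Integrable (fun x => ⟪u t x, φ x⟫) volume :=
    integrable_inner_of_locallyIntegrable_of_hasCompactSupport
      ((hu3 t ht).1.locallyIntegrable (by norm_num)) hφ.contDiff.continuous hφc
  have iv : Integrable (fun x => ⟪v t x, φ x⟫) volume :=
    integrable_inner_of_locallyIntegrable_of_hasCompactSupport
      ((hv3 t ht).1.locallyIntegrable (by norm_num)) hφ.contDiff.continuous hφc
  have Iu := intervalIntegrable_transportPairing hν hφ1 hφc ht.1 (ht.2.trans hT'.le) hmu hmu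
    ENNReal.coe_lt_top ENNReal.coe_lt_top hu3t hu3t
  have Iv := intervalIntegrable_transportPairing hν hφ1 hφc ht.1 (ht.2.trans hT'.le) hmv hmv
    ENNReal.coe_lt_top ENNReal.coe_lt_top hv3t hv3t
  have hid := h₁.integral_inner_sub_eq h₂ htT hφ hφd iu iv Iu Iv
  -- pointwise bound of the difference of the nonlinear pairings on `(0, t)`
  have hbd : ∀ τ ∈ Ioo 0 t,
      |(∫ x, ⟪u τ x, convect (u τ) (heatTest ν φ (t - τ)) x⟫) -
          ∫ x, ⟪v τ x, convect (v τ) (heatTest ν φ (t - τ)) x⟫| ≤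
        K * (eLpNorm φ 2 (volume : Measure E)).toReal * (t - τ) ^ (-(3 / 4 : ℝ)) := by
    intro τ hτ
    have hτ' : τ ∈ Icc 0 T' := ⟨hτ.1.le, hτ.2.le.trans ht.2⟩
    have hσ : 0 < t - τ := sub_pos.2 hτ.2
    have hΨ : MemLp (fderiv ℝ (heatTest ν φ (t - τ))) 3 (volume : Measure E) :=
      memLp_fderiv_heatTest hν hσ.le hφ1 hφc (by norm_num)
    have hΨb : eLpNorm (fderiv ℝ (heatTest ν φ (t - τ))) 3 volume ≤
        C * ENNReal.ofReal ((ν * (t - τ)) ^ (-(3 / 4 : ℝ))) * eLpNorm φ 2 volume := by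
      have h := hC φ hφ1 hφc (t - τ) hσ
      rwa [hexp] at h
    have hr0 : 0 ≤ (ν * (t - τ)) ^ (-(3 / 4 : ℝ)) := Real.rpow_nonneg (by positivity) _
    have hΨr : (eLpNorm (fderiv ℝ (heatTest ν φ (t - τ))) 3 (volume : Measure E)).toReal ≤
        C * (ν * (t - τ)) ^ (-(3 / 4 : ℝ)) * (eLpNorm φ 2 (volume : Measure E)).toReal := by
      have hfin : (C : ℝ≥0∞) * ENNReal.ofReal ((ν * (t - τ)) ^ (-(3 / 4 : ℝ))) *
          eLpNorm φ 2 volume ≠ ⊤ :=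
        ENNReal.mul_ne_top (ENNReal.mul_ne_top ENNReal.coe_ne_top ENNReal.ofReal_ne_top) hφ2.2.ne
      have := ENNReal.toReal_mono hfin hΨb
      rwa [ENNReal.toReal_mul, ENNReal.toReal_mul, ENNReal.coe_toReal,
        ENNReal.toReal_ofReal hr0] at this
    have hmain := abs_integral_inner_clm_apply_sub_le (hu3 τ hτ').1 (hv3 τ hτ').1 hΨ
      (hu3 τ hτ').2 (hv3 τ hτ').2
    simp only [convect]
    refine hmain.trans ?_
    rw [Real.mul_rpow hν.le hσ.le] at hΨr
    calc 4 * (M : ℝ) ^ 2 * (eLpNorm (fderiv ℝ (heatTest ν φ (t - τ))) 3 (volume : Measure E)).toReal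
        ≤ 4 * (M : ℝ) ^ 2 * (C * (ν ^ (-(3 / 4 : ℝ)) * (t - τ) ^ (-(3 / 4 : ℝ))) *
            (eLpNorm φ 2 (volume : Measure E)).toReal) := by gcongr
      _ = K * (eLpNorm φ 2 (volume : Measure E)).toReal * (t - τ) ^ (-(3 / 4 : ℝ)) := by
          rw [hK]; ring
  -- integrate the bound over `(0, t)`
  have hgi : IntervalIntegrable
      (fun τ => K * (eLpNorm φ 2 (volume : Measure E)).toReal * (t - τ) ^ (-(3 / 4 : ℝ)))
      volume 0 t := by
    have h := (intervalIntegral.intervalIntegrable_rpow' (a := t) (b := 0)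
      (by norm_num : (-1 : ℝ) < -(3 / 4))).comp_sub_left t
    simp only [sub_self, sub_zero] at h
    exact h.const_mul _
  have hae : ∀ᵐ τ ∂(volume : Measure ℝ), τ ∈ Ioc 0 t →
      ‖(∫ x, ⟪u τ x, convect (u τ) (heatTest ν φ (t - τ)) x⟫) -
          ∫ x, ⟪v τ x, convect (v τ) (heatTest ν φ (t - τ)) x⟫‖ ≤
        K * (eLpNorm φ 2 (volume : Measure E)).toReal * (t - τ) ^ (-(3 / 4 : ℝ)) := by
    filter_upwards [measure_eq_zero_iff_ae_notMem.1 (measure_singleton t)] with τ hτt hτ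
    rw [Real.norm_eq_abs]
    exact hbd τ ⟨hτ.1, lt_of_le_of_ne hτ.2 hτt⟩
  have hfin := intervalIntegral.norm_integral_le_of_norm_le ht.1 hae hgi
  rw [intervalIntegral.integral_const_mul, integral_rpow_neg_three_quarters, sub_zero,
    Real.norm_eq_abs] at hfin
  calc |∫ x, ⟪(u t - v t) x, φ x⟫|
      = |∫ τ in 0..t, ((∫ x, ⟪u τ x, convect (u τ) (heatTest ν φ (t - τ)) x⟫) -
          ∫ x, ⟪v τ x, convect (v τ) (heatTest ν φ (t - τ)) x⟫)| := by
        simp only [Pi.sub_apply]; rw [hid]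
    _ ≤ K * (eLpNorm φ 2 (volume : Measure E)).toReal * (4 * (t ^ (1 / 4 : ℝ))) := hfin
    _ ≤ K * (eLpNorm φ 2 (volume : Measure E)).toReal * (4 * (T' ^ (1 / 4 : ℝ))) := by
        gcongr
        · exact ht.1
        · exact ht.2
    _ = K * (4 * T' ^ (1 / 4 : ℝ)) * (eLpNorm φ 2 (volume : Measure E)).toReal := by ring

end APrioriL2


end Literature.Analysis.FluidPDE
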